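import Literature.NumberTheory.BeurlingPrimes.MergePowers
import Mathlib.Data.Nat.Nth
import HarnessLib

/-!
# Sub-systems of a Beurling prime system: deleting primes

Topic `Literature/NumberTheory/BeurlingPrimes`. Everything in this file is PROVED (definitions +
theorems). It is infrastructure for the second family of Broucke–Debruyne–Révész
(arXiv:2309.01567, Theorem 1.3 and §5 p. 16): "Our system `𝒫_{α,β}` is given by
`𝒫_{α,β} = ℙ ∪ ℙ^{1/β} ∖ 𝒫_𝒮`, with `π_{α,β}(x) = π(x) + π(x^β) − π_𝒮(x)`", where `𝒫_𝒮` is a set of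
rational primes to be deleted and "the remaining integers `𝒩 = {n ∈ ℕ : p | n ⇒ p ∉ 𝒫_𝒮}`".

For a Beurling generalized prime system `P` (`Literature.Barriers.RiemannHypothesis.BeurlingPrimes`)
and a set of indices `T ⊆ ℕ`:

* `BeurlingPrimes.psiOn P T x = ∑_{j ∈ T, λ_j^{k} ≤ x} log λ_j` — the part of `ψ_P(x)` carried by the
  primes with index in `T`; `psiOn_add_psiOn_compl : psiOn T + psiOn Tᶜ = ψ_P` (so deleting the
  primes indexed by `Tᶜ` subtracts `psiOn Tᶜ` from `ψ_P`), `psiOn_nonneg`, `psiOn_le_chebyshevPsi`,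
  `psiOn_mono`.
* `BeurlingPrimes.restrict P T hT` (`T` infinite): the sub-system `(λ_{t_j})_j` where `t_0 < t_1 < …`
  enumerates `T` (`Nat.nth`), i.e. the system obtained by deleting the primes with index outside `T`;
  `chebyshevPsi_restrict : ψ_{P|T} = psiOn T`, `genInt_restrict`, and
  `intCount_restrict : N_{P|T}(x) = #{k : supp k ⊆ T, genInt_P k ≤ x}` (its integers are the
  generalized integers of `P` all of whose prime factors have index in `T`),
  `primeCount_restrict : π_{P|T}(x) = #{j ∈ T : λ_j ≤ x}`.

## References
* [BrouckeDebruyneRevesz2023] F. Broucke, G. Debruyne, Sz. Gy. Révész, *Some examples of well-behaved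
  Beurling number systems*, arXiv:2309.01567 (Trans. AMS 2024), §5 p. 16 (read).
-/

noncomputable section

open Filter Set
open scoped Topology

namespace Literature.NumberTheory.BeurlingPrimes

open Literature.Barriers.RiemannHypothesis

variable (P : BeurlingPrimes) (T : Set ℕ)

/-! ### The part of `ψ_P` carried by a set of primes -/

/-- `psiOn T x = ∑_{j ∈ T, k ≥ 0, λ_j^{k+1} ≤ x} log λ_j`: the contribution to `ψ_P(x)` of the primes
with index in `T` (BDR's `ψ_𝒮` for the deleted primes `𝒫_𝒮`). [cite: BrouckeDebruyneRevesz2023, §5 p. 16] -/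
def _root_.Literature.Barriers.RiemannHypothesis.BeurlingPrimes.psiOn (x : ℝ) : ℝ :=
  ∑' jk : ℕ × ℕ, {jk : ℕ × ℕ | jk.1 ∈ T}.indicator (P.psiTerm x) jk

/-- The summand of `psiOn` is non-negative. [folklore] -/
theorem indicator_psiTerm_nonneg (x : ℝ) (jk : ℕ × ℕ) :
    0 ≤ {jk : ℕ × ℕ | jk.1 ∈ T}.indicator (P.psiTerm x) jk :=
  Set.indicator_nonneg (fun jk _ ↦ P.psiTerm_nonneg x jk) jk

/-- The summand of `psiOn` is at most the summand of `ψ_P`. [folklore] -/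
theorem indicator_psiTerm_le (x : ℝ) (jk : ℕ × ℕ) :
    {jk : ℕ × ℕ | jk.1 ∈ T}.indicator (P.psiTerm x) jk ≤ P.psiTerm x jk :=
  Set.indicator_le_self' (fun jk _ ↦ P.psiTerm_nonneg x jk) jk

/-- The family defining `psiOn T x` is summable (finitely supported). [folklore] -/
theorem summable_indicator_psiTerm (x : ℝ) :
    Summable fun jk : ℕ × ℕ ↦ {jk : ℕ × ℕ | jk.1 ∈ T}.indicator (P.psiTerm x) jk := by
  refine summable_of_ne_finset_zero (s := P.psiSupport x) fun jk hjk ↦ ?_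
  exact Set.indicator_apply_eq_zero.mpr fun _ ↦ P.psiTerm_eq_zero hjk

/-- `0 ≤ psiOn T x`. [folklore] -/
theorem _root_.Literature.Barriers.RiemannHypothesis.BeurlingPrimes.psiOn_nonneg (x : ℝ) : 0 ≤ P.psiOn T x :=
  tsum_nonneg fun jk ↦ indicator_psiTerm_nonneg P T x jk

/-- `psiOn T x ≤ ψ_P(x)`. [folklore] -/
theorem _root_.Literature.Barriers.RiemannHypothesis.BeurlingPrimes.psiOn_le_chebyshevPsi (x : ℝ) :
    P.psiOn T x ≤ P.chebyshevPsi x :=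
  Summable.tsum_le_tsum (fun jk ↦ indicator_psiTerm_le P T x jk) (summable_indicator_psiTerm P T x)
    (P.summable_psiTerm x)

/-- `psiOn T` is non-decreasing in `x`. [folklore] -/
theorem _root_.Literature.Barriers.RiemannHypothesis.BeurlingPrimes.psiOn_mono : Monotone (P.psiOn T) := by
  intro x y hxy
  refine Summable.tsum_le_tsum (fun jk ↦ ?_) (summable_indicator_psiTerm P T x) (summable_indicator_psiTerm P T y)
  exact Set.indicator_le_indicator_of_subset subset_rfl (fun jk ↦ P.psiTerm_nonneg y jk) jk |>.trans'
    (Set.indicator_le_indicator (P.psiTerm_mono hxy jk))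

/-- **`psiOn T + psiOn Tᶜ = ψ_P`**: deleting the primes with index in `Tᶜ` removes exactly `psiOn Tᶜ`
from `ψ_P` (BDR: `π_{α,β} = π + π(x^β) − π_𝒮`). [cite: BrouckeDebruyneRevesz2023, §5 p. 16] -/
theorem _root_.Literature.Barriers.RiemannHypothesis.BeurlingPrimes.psiOn_add_psiOn_compl (x : ℝ) :
    P.psiOn T x + P.psiOn Tᶜ x = P.chebyshevPsi x := by
  unfold BeurlingPrimes.psiOn
  rw [← (summable_indicator_psiTerm P T x).tsum_add (summable_indicator_psiTerm P Tᶜ x),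
    P.chebyshevPsi_eq_tsum]
  refine tsum_congr fun jk ↦ ?_
  have hset : ({jk : ℕ × ℕ | jk.1 ∈ Tᶜ} : Set (ℕ × ℕ)) = {jk : ℕ × ℕ | jk.1 ∈ T}ᶜ := by
    ext jk; simp
  rw [hset]
  exact congrFun (Set.indicator_self_add_compl {jk : ℕ × ℕ | jk.1 ∈ T} (P.psiTerm x)) jk

/-- `psiOn T` as a finite sum over `psiSupport x`. [folklore] -/
theorem _root_.Literature.Barriers.RiemannHypothesis.BeurlingPrimes.psiOn_eq_sum (x : ℝ) :
    P.psiOn T x = ∑ jk ∈ P.psiSupport x, {jk : ℕ × ℕ | jk.1 ∈ T}.indicator (P.psiTerm x) jk :=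
  tsum_eq_sum fun _ hjk ↦ Set.indicator_apply_eq_zero.mpr fun _ ↦ P.psiTerm_eq_zero hjk

/-! ### The sub-system indexed by an infinite set -/

variable {T}

/-- `{j | j ∈ T}` is infinite when `T` is. [folklore] -/
theorem infinite_setOf_mem (hT : T.Infinite) : (setOf fun j ↦ j ∈ T).Infinite := hT

/-- **The sub-system `P|T`**: the primes `λ_{t_0} ≤ λ_{t_1} ≤ …` where `t_0 < t_1 < …` enumerates the
infinite index set `T` (BDR's `ℙ ∖ 𝒫_𝒮`, with `T` the indices of the primes kept).
[cite: BrouckeDebruyneRevesz2023, §5 p. 16] -/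
def _root_.Literature.Barriers.RiemannHypothesis.BeurlingPrimes.restrict (hT : T.Infinite) : BeurlingPrimes where
  prime j := P.prime (Nat.nth (fun i ↦ i ∈ T) j)
  one_lt := P.one_lt_prime _
  mono _ _ hij := P.mono ((Nat.nth_strictMono (infinite_setOf_mem hT)).monotone hij)
  tendsto_atTop := P.tendsto_atTop.comp (Nat.nth_strictMono (infinite_setOf_mem hT)).tendsto_atTop

/-- The primes of `P|T` are `λ_{t_j}`. [folklore] -/
@[simp] theorem _root_.Literature.Barriers.RiemannHypothesis.BeurlingPrimes.prime_restrict (hT : T.Infinite) (j : ℕ) :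
    (P.restrict hT).prime j = P.prime (Nat.nth (fun i ↦ i ∈ T) j) := rfl

/-- `t_j ∈ T`. [folklore] -/
theorem nth_mem (hT : T.Infinite) (j : ℕ) : Nat.nth (fun i ↦ i ∈ T) j ∈ T :=
  Nat.nth_mem_of_infinite (infinite_setOf_mem hT) j

/-- Every element of `T` is some `t_j`. [folklore] -/
theorem exists_nth_eq (hT : T.Infinite) {i : ℕ} (hi : i ∈ T) : ∃ j, Nat.nth (fun i ↦ i ∈ T) j = i := by
  have h : i ∈ Set.range (Nat.nth fun i ↦ i ∈ T) := by
    rw [Nat.range_nth_of_infinite (infinite_setOf_mem hT)]; exact hi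
  exact h

/-- The bijection `ℕ × ℕ ≃ {(i, k) : i ∈ T}`, `(j, k) ↦ (t_j, k)`. [folklore] -/
def restrictProdEquiv (hT : T.Infinite) : ℕ × ℕ ≃ {jk : ℕ × ℕ // jk ∈ {jk : ℕ × ℕ | jk.1 ∈ T}} :=
  Equiv.ofBijective (fun jk ↦ ⟨(Nat.nth (fun i ↦ i ∈ T) jk.1, jk.2), nth_mem hT jk.1⟩)
    ⟨fun a b hab ↦ by
      have h := Subtype.ext_iff.mp hab
      simp only [Prod.mk.injEq] at h
      exact Prod.ext (Nat.nth_injective (infinite_setOf_mem hT) h.1) h.2,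
     fun q ↦ by
      obtain ⟨j, hj⟩ := exists_nth_eq hT (q.2 : q.1.1 ∈ T)
      refine ⟨(j, q.1.2), Subtype.ext ?_⟩
      simp [hj]⟩

/-- **`ψ_{P|T}(x) = psiOn T x`**. [cite: BrouckeDebruyneRevesz2023, §5 p. 16] -/
theorem _root_.Literature.Barriers.RiemannHypothesis.BeurlingPrimes.chebyshevPsi_restrict (hT : T.Infinite) (x : ℝ) :
    (P.restrict hT).chebyshevPsi x = P.psiOn T x := by
  rw [BeurlingPrimes.chebyshevPsi_eq_tsum, BeurlingPrimes.psiOn, ← tsum_subtype,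
    ← Equiv.tsum_eq (restrictProdEquiv hT)]
  rfl

/-- The generalized integers of `P|T` are those of `P` with exponent vector transported along `j ↦ t_j`. [folklore] -/
theorem _root_.Literature.Barriers.RiemannHypothesis.BeurlingPrimes.genInt_restrict (hT : T.Infinite) (k : ℕ →₀ ℕ) :
    (P.restrict hT).genInt k = P.genInt (Finsupp.mapDomain (Nat.nth fun i ↦ i ∈ T) k) := by
  unfold BeurlingPrimes.genInt
  rw [Finsupp.prod_mapDomain_index_inj (Nat.nth_injective (infinite_setOf_mem hT))]
  rfl

/-- The exponent vectors of `P` supported in `T` correspond to the exponent vectors of `P|T`. [folklore] -/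
def restrictExpEquiv (hT : T.Infinite) : (ℕ →₀ ℕ) ≃ {k : ℕ →₀ ℕ // (k.support : Set ℕ) ⊆ T} where
  toFun k := ⟨Finsupp.mapDomain (Nat.nth fun i ↦ i ∈ T) k, by
    classical
    rw [Finsupp.mapDomain_support_of_injective (Nat.nth_injective (infinite_setOf_mem hT))]
    intro i hi
    simp only [Finset.coe_image, Set.mem_image, Finset.mem_coe] at hi
    obtain ⟨j, -, rfl⟩ := hi
    exact nth_mem hT j⟩
  invFun k := Finsupp.comapDomain (Nat.nth fun i ↦ i ∈ T) k.1
    (Nat.nth_injective (infinite_setOf_mem hT)).injOn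
  left_inv k := Finsupp.comapDomain_mapDomain _ (Nat.nth_injective (infinite_setOf_mem hT)) k
  right_inv k := by
    refine Subtype.ext (Finsupp.mapDomain_comapDomain _ (Nat.nth_injective (infinite_setOf_mem hT)) k.1 ?_)
    rw [Nat.range_nth_of_infinite (infinite_setOf_mem hT)]
    exact k.2

/-- **`N_{P|T}(x) = #{k : supp k ⊆ T, genInt_P k ≤ x}`**: the integers of `P|T` are the generalized
integers of `P` all of whose prime factors have index in `T` (BDR: "`𝒩 = {n ∈ ℕ : p | n ⇒ p ∉ 𝒫_𝒮}`").
[cite: BrouckeDebruyneRevesz2023, §5 p. 16] -/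
theorem _root_.Literature.Barriers.RiemannHypothesis.BeurlingPrimes.intCount_restrict (hT : T.Infinite) (x : ℝ) :
    (P.restrict hT).intCount x = Nat.card {k : ℕ →₀ ℕ // (k.support : Set ℕ) ⊆ T ∧ P.genInt k ≤ x} := by
  unfold BeurlingPrimes.intCount
  have e1 : {k : ℕ →₀ ℕ // (P.restrict hT).genInt k ≤ x} ≃
      {q : {k : ℕ →₀ ℕ // (k.support : Set ℕ) ⊆ T} // P.genInt q.1 ≤ x} :=
    Equiv.subtypeEquiv (restrictExpEquiv hT) fun k ↦ by
      rw [BeurlingPrimes.genInt_restrict]; rfl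
  exact Nat.card_congr (e1.trans (Equiv.subtypeSubtypeEquivSubtypeInter
    (fun k : ℕ →₀ ℕ ↦ (k.support : Set ℕ) ⊆ T) (fun k ↦ P.genInt k ≤ x)))

/-- The enumeration `j ↦ t_j` as a bijection `ℕ ≃ T`. [folklore] -/
def restrictIndexEquiv (hT : T.Infinite) : ℕ ≃ {j : ℕ // j ∈ T} :=
  Equiv.ofBijective (fun j ↦ ⟨Nat.nth (fun i ↦ i ∈ T) j, nth_mem hT j⟩)
    ⟨fun a b hab ↦ Nat.nth_injective (infinite_setOf_mem hT) (Subtype.ext_iff.mp hab),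
     fun i ↦ by obtain ⟨j, hj⟩ := exists_nth_eq hT i.2; exact ⟨j, Subtype.ext hj⟩⟩

/-- **`π_{P|T}(x) = #{j ∈ T : λ_j ≤ x}`**. [cite: BrouckeDebruyneRevesz2023, §5 p. 16] -/
theorem _root_.Literature.Barriers.RiemannHypothesis.BeurlingPrimes.primeCount_restrict (hT : T.Infinite) (x : ℝ) :
    (P.restrict hT).primeCount x = Nat.card {j : ℕ // j ∈ T ∧ P.prime j ≤ x} := by
  unfold BeurlingPrimes.primeCount
  have e1 : {j : ℕ // (P.restrict hT).prime j ≤ x} ≃ {q : {j : ℕ // j ∈ T} // P.prime q.1 ≤ x} :=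
    Equiv.subtypeEquiv (restrictIndexEquiv hT) fun j ↦ Iff.rfl
  exact Nat.card_congr (e1.trans (Equiv.subtypeSubtypeEquivSubtypeInter
    (fun j : ℕ ↦ j ∈ T) (fun j ↦ P.prime j ≤ x)))

end Literature.NumberTheory.BeurlingPrimes
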